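import Summits.HodgeConjecture.HodgeConjecture.Theses.CMComplexitySaturation
import Literature.AlgebraicGeometry.HodgeTheory.ComplexConjugationHolds

/-!
# Route `CMComplexitySaturation` — support item `HodgeModels` (stmt-HodgeConjecture-20099)

The support item `HodgeModels` of route `CMComplexitySaturation` —
`∀ n X, Literature.AlgebraicGeometry.HodgeTheory.nonempty_hodgeModel n X` (every smooth projective complex
variety of dimension `n` has a Hodge model: Serre's analytification, de Rham's theorem, the Hodge
decomposition of the compact Kähler manifold `X^an`) — is the `CMComplexitySaturation` copy of the shared
support statement stmt-HodgeConjecture-1943 (`NodalSupport.HodgeModels`, closed by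
`Theorems.nodalSupport_hodgeModels_proof`).  The named fact is discharged in the Literature library by
`Literature.AlgebraicGeometry.HodgeTheory.nonempty_hodgeModel_holds` (`HodgeTheory/ComplexConjugationHolds`,
relying on nothing unproved), so the item closes by the same one-line proof against this route's decl.
No definition, no named-fact hypothesis, no sorry.
-/

set_option linter.dupNamespace false

noncomputable section

namespace Summit.HodgeConjecture.HodgeConjecture.Theorems

/-- **Item stmt-HodgeConjecture-20099 (`HodgeModels`, route `CMComplexitySaturation`)**: every smooth
projective complex variety has a Hodge model — `∀ n X, nonempty_hodgeModel n X` — by the Literature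
discharge `nonempty_hodgeModel_holds` (Serre GAGA §2: analytification; de Rham; Voisin (2002) §6.1.3
Prop. 6.11: Hodge decomposition of compact Kähler manifolds).  The type is literally the route decl
`Summit.HodgeConjecture.HodgeConjecture.Theses.CMComplexitySaturation.HodgeModels`.
[cite: SerreGAGA1956, §2 n°5 Prop. 2 and n°7 Prop. 6]
[cite: VoisinHodgeI2002, §3.3.2 and §6.1.3 Prop. 6.11] -/
theorem cmComplexitySaturation_hodgeModels_proof :
    Summit.HodgeConjecture.HodgeConjecture.Theses.CMComplexitySaturation.HodgeModels := by
  unfold Summit.HodgeConjecture.HodgeConjecture.Theses.CMComplexitySaturation.HodgeModels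
  exact fun n X ↦ Literature.AlgebraicGeometry.HodgeTheory.nonempty_hodgeModel_holds

end Summit.HodgeConjecture.HodgeConjecture.Theorems

end
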